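import Summits.ValiantsHypothesis.ValiantsHypothesis.Theorems.BarrierLeverTransversalMinorLayoutsRankEightCellFourB

/-!
# Route BarrierLever — item `TransversalLayoutsRankLeEight` (stmt-ValiantsHypothesis-19933), PROVED:
# TT for layouts with at most EIGHT rows, every height

Closing file (`--workitem stmt-ValiantsHypothesis-19933`; cell valiant-natproofs, rung V4, 𝒟-side of
door (c); seat val-np-p1 gen 8; item typed by planner p1-g13 after prover gen 8's HUB-MEMO §7
«TT(r ≤ 8, all h)»).  The bounded locked-complex engine (`FiniteCheck.tt_rank_le_of_lockedCore`,
p484340: R1 + lower-set reduction, val-np-p2 / val-np-p1 g5) reduces TT for `r ≤ 8` rows to the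
LOCKED pairs of complexes with `r ≤ 8` faces at heights `h < r`, one side using every coordinate.
`r ≤ 7` is `…RankSeven`; `h ≤ 3` is the tree's `PPSmall.transversalMinorLayouts_nonsingular_of_le_three`
(val-np-p1 g7); the four cells with eight faces are `good_claw_h7_r8` (`…RankEightCellSeven`),
`good_clawEdge_h6_r8`, `good_twoEdges_h5_r8` (`…RankEightCells`) and `good_threeEdges_h4_r8`
(`…RankEightCellFour{A,B}`), resting on nine kernel certificates (eight priority-peeling
derivations emitted by prover gen 7's `pp_emit.py`, one compression-word certificate checked by
prover gen 9's `HubCert.tt_of_wordCerts`) and the classification of eight-face complexes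
(`…EightFaces*`).

* `transversalMinorLayouts_nonsingular_of_r_le_eight` — item 19152's conclusion for every
  injective layout pair with `r ≤ 8` rows, at every height;
* `transversalLayoutsRankLeEight` — the route declaration, by name.

WHAT THIS IS NOT: a bounded-rank slice of TT (eight rows, any number of coordinates); nothing on
TT (19152) / `HubCertificatesExist` (19930) in general, on crux stmt-ValiantsHypothesis-14610, or on
`VP` versus `VNP`.
-/

-- layout Summits/ValiantsHypothesis/ValiantsHypothesis forces the duplicated namespace component
set_option linter.dupNamespace false

open Matrix Finset

namespace Summit.ValiantsHypothesis.ValiantsHypothesis.Theorems.BarrierLever.FiniteCheck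

open Summit.ValiantsHypothesis.ValiantsHypothesis.Theorems.BarrierLever.Compression
open Summit.ValiantsHypothesis.ValiantsHypothesis.Theorems.BarrierLever.PriorityPeeling

/-- **TT for `r ≤ 8` rows, every `h`** (conclusion of item 19152 verbatim for these layouts). -/
theorem transversalMinorLayouts_nonsingular_of_r_le_eight (h r : ℕ) (hr : r ≤ 8)
    (u w : Fin r → Finset (Fin h)) (hu : Function.Injective u) (hw : Function.Injective w) :
    ∃ H : Matrix (Fin (h + h)) (Fin (h + h)) ℂ, (Matrix.of fun i j : Fin r => (H.submatrix
      (fun a : Fin h => if a ∈ u i then Fin.castAdd h a else Fin.natAdd h a)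
      (fun c : Fin h => if c ∈ w j then Fin.natAdd h c else Fin.castAdd h c)).det).det ≠ 0 := by
  classical
  refine tt_rank_le_of_lockedCore 8 (fun h r hr hhr u w hu hw hlu hlw hlk => ?_) h r hr u w hu hw
  by_cases hr7 : r ≤ 7
  · exact transversalMinorLayouts_nonsingular_of_r_le_seven h r hr7 u w hu hw
  have hr8 : r = 8 := by omega
  subst hr8
  by_cases hh : h ≤ 3
  · exact PPSmall.transversalMinorLayouts_nonsingular_of_le_three h 8 hh u w hu hw
  have key : ∀ (u w : Fin 8 → Finset (Fin h)), Function.Injective u → Function.Injective w →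
      IsLowerSet (Set.range u) → IsLowerSet (Set.range w) →
      (∀ (a c : Fin h) (β γ : Bool),
        (Finset.univ.filter fun i => (a ∈ u i ↔ β = true)).card ≠
          (Finset.univ.filter fun j => (c ∈ w j ↔ γ = true)).card) →
      (∀ a : Fin h, ∃ i, a ∈ u i) →
      ∃ H : Matrix (Fin (h + h)) (Fin (h + h)) ℂ, (Matrix.of fun i j : Fin 8 => (H.submatrix
        (fun a : Fin h => if a ∈ u i then Fin.castAdd h a else Fin.natAdd h a)
        (fun c : Fin h => if c ∈ w j then Fin.natAdd h c else Fin.castAdd h c)).det).det ≠ 0 := by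
    intro u w hu hw hlu hlw hlk hfull
    have hclash : ∀ (a c : Fin h), (Finset.univ.filter fun i => a ∈ u i).card ≠
        (Finset.univ.filter fun j => c ∈ w j).card := by
      intro a c e
      apply hlk a c true true
      simp only [iff_true]
      exact e
    by_cases h7 : h = 7
    · subst h7
      have hdu := degree_eq_one_of_claw u hu hlu hfull rfl
      exact good_claw_h7_r8 u w hu hw hlu hlw hfull (fun c hc => hclash 0 c (by rw [hdu, hc]))
    by_cases h6 : h = 6
    · subst h6
      exact good_clawEdge_h6_r8 u w hu hw hlu hlw hfull hclash
    by_cases h5 : h = 5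
    · subst h5
      exact good_twoEdges_h5_r8 u w hu hw hlu hlw hfull hclash
    · have h4 : h = 4 := by omega
      subst h4
      exact good_threeEdges_h4_r8 u w hu hw hlu hlw hfull hclash
  rcases full_or_full_of_locked u w hlk with hfu | hfw
  · exact key u w hu hw hlu hlw hlk hfu
  · exact tt_layout_swap h 8 u w (key w u hw hu hlw hlu (fun a c β γ e => hlk c a γ β e.symm) hfw)

/-- **Item stmt-ValiantsHypothesis-19933 `TransversalLayoutsRankLeEight` holds**, by name. -/
theorem transversalLayoutsRankLeEight :
    Summit.ValiantsHypothesis.ValiantsHypothesis.Theses.BarrierLever.TransversalLayoutsRankLeEight :=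
  fun h r u w hr hu hw => transversalMinorLayouts_nonsingular_of_r_le_eight h r hr u w hu hw

end Summit.ValiantsHypothesis.ValiantsHypothesis.Theorems.BarrierLever.FiniteCheck
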